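import Literature.Probability.RandomPlanarGeometry.ChordalCurveFamily
import Literature.Probability.RandomPlanarGeometry.LoopSpaceMaps
import Literature.Topology.PlaneTopology.Crosscut
import HarnessLib

/-!
# Reversibility of chordal curve families; the swapped Dobrushin domain

Topic `Literature/Probability/RandomPlanarGeometry` (definition item `defn-ChordalFamily.IsReversible`,
for crux `stmt-CriticalPhenomena-1368` = `Rigidity` of route SAWRestrictionRigidity, hypothesis (iv)).

A chordal curve family `P : DobrushinDomain → Measure (CurveClass ℂ)` is **reversible** if the law of
the curve from `b` to `a` in `D` is the time reversal of the law of the curve from `a` to `b`: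

* `ChordalFamily.IsReversible P` — for all Dobrushin structures `D, D'` on the same carrier with the
  two marked points exchanged (`D'.pt 0 = D.pt 1`, `D'.pt 1 = D.pt 0`),
  `P D' = (P D).map CurveClass.reverse`. This is LITERALLY the clause inlined in the route
  (`isReversible_iff` is `Iff.rfl`), phrased without constructing the swapped domain.

Sources. Lawler–Schramm–Werner 2004 (SAW), §2.2: "every [chordal conformal restriction] family
satisfies the symmetry relation `P^a(z,w;D) = P^a(w,z;D)`" (laws of unparametrised hulls); §3.1: the
measure `μ_SAW` gives weight `β^{-n}` to each self-avoiding walk of length `n`, a weight invariant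
under the reversal `ω ↦ ω^R = [ω_n, …, ω_0]`, so the `x_c`-weighted SAW from `z` to `w` in a domain
is EXACTLY the reversal of the SAW from `w` to `z` (the lattice identity the route passes to the
limit). For chordal SLE_κ reversibility is a theorem for `κ ∈ (0, 4]` (Zhan 2008: "the chordal
SLE_κ trace is reversible for `κ ∈ (0,4]`"), in particular for SLE_{8/3}.

API shipped with the definition:

* `MarkedDomain.swap : DobrushinDomain → DobrushinDomain` — the genuine construction `(D; b, a)` of
  the swapped Dobrushin domain: the boundary loop re-based at the second mark
  (`t ↦ ∂D (t + mark 1)`), marks `(0, 1 + mark 0 − mark 1)`; `carrier_swap`, `pt_swap_zero`,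
  `pt_swap_one`, and the two boundary arcs are exchanged (`arc_swap_zero`, `arc_swap_one`).
  Injectivity of the re-based loop on `Ico 0 1` is `JordanDomain.injOn_boundary_Ico` (a `1`-periodic
  loop injective on `Ico 0 1` is injective on every period `Ico a (a + 1)`), reused from
  `Literature.Topology.PlaneTopology.Crosscut`.
* `CurveClass.measurable_reverse`, `CurveClass.reverseMeasurableEquiv` (time reversal is a
  measurable involution, an isometry by `CurveClass.isometry_reverse`), `map_reverse_apply` (on ALL
  sets), `map_reverse_map_reverse`, `source_reverse`, `target_reverse`, `preimage_reverse_rangeSubset`,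
  `preimage_reverse_simple`.
* `IsReversible.apply_swap : P D.swap = (P D).map reverse`, `IsReversible.map_reverse_eq`,
  `IsReversible.ae_swap_iff`; the converse `isReversible_of_swap` / `isReversible_iff_swap` for
  families depending on `D` only through `(carrier, pt 0, pt 1)`, which is automatic for chordal
  restriction families (`IsRestriction.eq_of_carrier_eq`, from `IsChordal.measure_rangeSubset`).
* Non-vacuity: `segmentFamily` (Dirac mass on the straight segment from `a` to `b`) is reversible
  (`isReversible_segmentFamily`); it is neither chordal in non-convex domains nor a restriction
  family — no example with all the route's axioms is claimed (that is the content of the crux).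

## References

* G. F. Lawler, O. Schramm, W. Werner, *On the scaling limit of planar self-avoiding walk*,
  Proc. Sympos. Pure Math. 72.2 (2004) 339–364, arXiv:math/0204277, §2.2, §3.1.
  [cite: LawlerSchrammWerner2004SAW, §2.2]
* D. Zhan, *Reversibility of chordal SLE*, Ann. Probab. 36 (2008) 1472–1494, arXiv:0808.3649.
  [cite: Zhan2008Reversibility, abstract / main theorem]
* G. F. Lawler, O. Schramm, W. Werner, *Conformal restriction: the chordal case*, J. Amer. Math.
  Soc. 16 (2003), §1, §3. [cite: LawlerSchrammWerner2003Restriction, §3]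
* W. Werner, *Lectures on two-dimensional critical percolation* (2007), §2–3 (Dobrushin domains).

## Mathlib / tree

Mathlib: `MeasurableEquiv.map_apply`, `Measure.map_map`, `measure_inter_conull`,
`prob_compl_eq_zero_iff`, `Set.image_add_const_Icc`, `Measure.map_dirac'`.
Tree: `DobrushinDomain`, `MarkedDomain.pt/arc/nextMark` (PlanarDomains);
`JordanDomain.injOn_boundary_Ico` (PlaneTopology/Crosscut); `ChordalFamily`,
`IsChordal`, `IsRestriction` (ChordalCurveFamily); `CurveClass.reverse`, `isometry_reverse`,
`reverse_reverse`, `range_reverse` (LoopSpaceMaps); `CurveClass.rangeSubset`, `simple`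
(CurveSpace). Searched `lean search 'IsReversible|reversible'` in RandomPlanarGeometry: only
Loewner-chain reversals (BackwardLoewnerReversal), no law-level reversibility predicate.
-/

noncomputable section

open Set MeasureTheory Function
open scoped unitInterval ENNReal

namespace Literature.Probability.RandomPlanarGeometry

/-! ### Time reversal on curve space: measurability, endpoints, events -/

namespace Curve

variable {E : Type*} [TopologicalSpace E]

/-- The reversal of a simple (injective) curve is simple. [folklore] -/
theorem IsSimple.reverse {γ : Curve E} (h : γ.IsSimple) : γ.reverse.IsSimple :=
  fun s t hst => unitInterval.symm_bijective.injective (h (by simpa using hst))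

/-- The constant curve is its own reversal. [folklore] -/
@[simp] theorem reverse_const (x : E) : (const x).reverse = const x := by
  ext t
  simp

end Curve

namespace CurveClass

variable {E : Type*} [MetricSpace E]

/-- Time reversal of curve classes is continuous (it is an isometry). [folklore] -/
theorem continuous_reverse : Continuous (reverse : CurveClass E → CurveClass E) :=
  isometry_reverse.continuous

/-- Time reversal of curve classes is Borel measurable. [folklore] -/
@[fun_prop]
theorem measurable_reverse : Measurable (reverse : CurveClass E → CurveClass E) :=
  continuous_reverse.measurable

/-- Time reversal is an involution of curve space. [folklore] -/
theorem reverse_involutive : Involutive (reverse : CurveClass E → CurveClass E) :=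
  reverse_reverse

/-- Time reversal is a bijection of curve space. [folklore] -/
theorem reverse_bijective : Bijective (reverse : CurveClass E → CurveClass E) :=
  reverse_involutive.bijective

/-- `reverse ∘ reverse = id`. [folklore] -/
@[simp] theorem reverse_comp_reverse :
    (reverse : CurveClass E → CurveClass E) ∘ reverse = id :=
  reverse_involutive.comp_self

/-- The reversed class starts at the old end point. [folklore] -/
@[simp] theorem source_reverse (c : CurveClass E) : c.reverse.source = c.target := by
  obtain ⟨γ, rfl⟩ := surjective_mk c
  simp

/-- The reversed class ends at the old starting point. [folklore] -/
@[simp] theorem target_reverse (c : CurveClass E) : c.reverse.target = c.source := by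
  obtain ⟨γ, rfl⟩ := surjective_mk c
  simp

/-- The class of a constant curve is its own reversal. [folklore] -/
@[simp] theorem reverse_mk_const (x : E) : (mk (Curve.const x)).reverse = mk (Curve.const x) := by
  simp

/-- "Staying inside `S`" is a reversal-invariant event. [folklore] -/
@[simp] theorem preimage_reverse_rangeSubset (S : Set E) :
    reverse ⁻¹' rangeSubset S = rangeSubset S := by
  ext c
  simp

/-- The reversal of a simple class is simple. [folklore] -/
theorem reverse_mem_simple {c : CurveClass E} (h : c ∈ simple) : c.reverse ∈ simple := by
  obtain ⟨γ, hγ, rfl⟩ := h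
  exact ⟨γ.reverse, Curve.IsSimple.reverse hγ, rfl⟩

/-- Simplicity is a reversal-invariant event. [folklore] -/
@[simp] theorem reverse_mem_simple_iff {c : CurveClass E} : c.reverse ∈ simple ↔ c ∈ simple :=
  ⟨fun h => by simpa using reverse_mem_simple h, reverse_mem_simple⟩

/-- Simplicity is a reversal-invariant event (preimage form). [folklore] -/
@[simp] theorem preimage_reverse_simple :
    reverse ⁻¹' (simple : Set (CurveClass E)) = simple := by
  ext c
  simp

/-- Time reversal as a measurable equivalence of curve space (its own inverse). [folklore] -/
def reverseMeasurableEquiv : CurveClass E ≃ᵐ CurveClass E where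
  toFun := reverse
  invFun := reverse
  left_inv := reverse_reverse
  right_inv := reverse_reverse
  measurable_toFun := measurable_reverse
  measurable_invFun := measurable_reverse

/-- The underlying map of `reverseMeasurableEquiv` is `reverse`. [folklore] -/
@[simp] theorem coe_reverseMeasurableEquiv :
    ⇑(reverseMeasurableEquiv : CurveClass E ≃ᵐ CurveClass E) = reverse := rfl

/-- Time reversal is a measurable embedding (so push-forwards are computed on all sets). [folklore] -/
theorem measurableEmbedding_reverse :
    MeasurableEmbedding (reverse : CurveClass E → CurveClass E) :=
  reverseMeasurableEquiv.measurableEmbedding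

/-- The reversed law of an event is the law of the reversed event, for EVERY set (measurable or
not), because reversal is a measurable equivalence. [folklore] -/
theorem map_reverse_apply (μ : Measure (CurveClass E)) (s : Set (CurveClass E)) :
    μ.map reverse s = μ (reverse ⁻¹' s) :=
  reverseMeasurableEquiv.map_apply s

/-- Reversing a law twice gives it back. [folklore] -/
@[simp] theorem map_reverse_map_reverse (μ : Measure (CurveClass E)) :
    (μ.map reverse).map reverse = μ := by
  rw [Measure.map_map measurable_reverse measurable_reverse, reverse_comp_reverse, Measure.map_id]

/-- Push-forward by reversal is injective on laws. [folklore] -/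
theorem map_reverse_injective :
    Injective (Measure.map (reverse : CurveClass E → CurveClass E)) := fun μ ν h => by
  rw [← map_reverse_map_reverse μ, h, map_reverse_map_reverse]

/-- The reversal of a probability law is a probability law. [folklore] -/
instance isProbabilityMeasure_map_reverse (μ : Measure (CurveClass E)) [IsProbabilityMeasure μ] :
    IsProbabilityMeasure (μ.map reverse) :=
  Measure.isProbabilityMeasure_map measurable_reverse.aemeasurable

/-- Almost-sure statements transfer along reversal. [folklore] -/
theorem ae_map_reverse_iff {μ : Measure (CurveClass E)} {p : CurveClass E → Prop} :
    (∀ᵐ c ∂(μ.map reverse), p c) ↔ ∀ᵐ c ∂μ, p c.reverse :=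
  measurableEmbedding_reverse.ae_map_iff

end CurveClass

/-! ### The swapped Dobrushin domain `(D; b, a)` -/

namespace MarkedDomain

/-- For a Dobrushin domain, the mark after `mark 0` is `mark 1`. [folklore] -/
@[simp] theorem nextMark_zero_two (D : DobrushinDomain) : D.nextMark 0 = D.mark 1 := by
  simp [nextMark]

/-- For a Dobrushin domain, the mark after `mark 1` is `mark 0 + 1` (wrap-around). [folklore] -/
@[simp] theorem nextMark_one_two (D : DobrushinDomain) : D.nextMark 1 = D.mark 0 + 1 := by
  simp [nextMark]

/-- The first mark of a Dobrushin domain precedes the second. [folklore] -/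
theorem mark_zero_lt_mark_one (D : DobrushinDomain) : D.mark 0 < D.mark 1 :=
  D.strictMono_mark (show (0 : Fin 2) < 1 by decide)

/-- **The swapped Dobrushin domain** `(D; b, a)`: same Jordan domain, the two marked points
exchanged. Since marks must increase within the fundamental period, the boundary loop is re-based
at the second mark, `t ↦ ∂D (t + mark 1)`, and the new marks are `0` (old `b`) and
`1 + mark 0 − mark 1` (old `a`, reached after wrapping around). The arc from the new first point
to the new second point is the old second arc `(ba)` and conversely (`arc_swap_zero/one`).
Werner 2007 §2 ("domain with two marked boundary points"); used to phrase reversibility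
`P (D; b, a) = reverse_* P (D; a, b)` (LSW 2004 §2.2). [folklore] -/
def swap (D : DobrushinDomain) : DobrushinDomain where
  carrier := D.carrier
  boundary t := D.boundary (t + D.mark 1)
  isOpen := D.isOpen
  isBounded := D.isBounded
  isConnected := D.isConnected
  continuous_boundary := D.continuous_boundary.comp (continuous_id.add continuous_const)
  periodic_boundary := D.periodic_boundary.add_const _
  injOn_boundary s hs t ht hst :=
    add_right_cancel (D.injOn_boundary_Ico (D.mark 1)
      (show s + D.mark 1 ∈ Ico (D.mark 1) (D.mark 1 + 1) from
        ⟨by linarith [hs.1], by linarith [hs.2]⟩)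
      (show t + D.mark 1 ∈ Ico (D.mark 1) (D.mark 1 + 1) from
        ⟨by linarith [ht.1], by linarith [ht.2]⟩)
      (show D.boundary (s + D.mark 1) = D.boundary (t + D.mark 1) from hst))
  range_boundary := by
    rw [show (fun t => D.boundary (t + D.mark 1)) = D.boundary ∘ fun t => t + D.mark 1 from rfl,
      (add_right_surjective _).range_comp]
    exact D.range_boundary
  mark := ![0, 1 + D.mark 0 - D.mark 1]
  strictMono_mark := by
    refine Fin.strictMono_iff_lt_succ.2 fun k ↦ ?_
    fin_cases k
    have h0 := (D.mark_mem 0).1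
    have h1 := (D.mark_mem 1).2
    simp only [Fin.zero_eta, Fin.castSucc_zero, Matrix.cons_val_zero, Fin.succ_zero_eq_one,
      Matrix.cons_val_one]
    linarith
  mark_mem k := by
    have h0 := (D.mark_mem 0).1
    have h1 := (D.mark_mem 1).2
    have h01 := D.mark_zero_lt_mark_one
    fin_cases k
    · simp
    · simp only [Fin.mk_one, Matrix.cons_val_one, Matrix.cons_val_zero, mem_Ico]
      constructor <;> linarith

variable (D : DobrushinDomain)

/-- Swapping the marked points does not change the domain. [folklore] -/
@[simp] theorem carrier_swap : D.swap.carrier = D.carrier := rfl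

/-- The boundary loop of the swapped domain is the old loop re-based at the second mark. [folklore] -/
@[simp] theorem boundary_swap (t : ℝ) : D.swap.boundary t = D.boundary (t + D.mark 1) := rfl

/-- The first mark of the swapped domain is `0`. [folklore] -/
@[simp] theorem mark_swap_zero : D.swap.mark 0 = 0 := rfl

/-- The second mark of the swapped domain is `1 + mark 0 − mark 1`. [folklore] -/
@[simp] theorem mark_swap_one : D.swap.mark 1 = 1 + D.mark 0 - D.mark 1 := rfl

/-- The first marked point of `(D; b, a)` is `b`. [folklore] -/
@[simp] theorem pt_swap_zero : D.swap.pt 0 = D.pt 1 := by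
  simp [pt]

/-- The second marked point of `(D; b, a)` is `a`. [folklore] -/
@[simp] theorem pt_swap_one : D.swap.pt 1 = D.pt 0 := by
  simp only [pt, boundary_swap, mark_swap_one]
  rw [show 1 + D.mark 0 - D.mark 1 + D.mark 1 = D.mark 0 + 1 by ring, D.periodic_boundary]

/-- The frontier of the swapped domain is unchanged. [folklore] -/
theorem frontier_swap : frontier D.swap.carrier = frontier D.carrier := rfl

/-- The first arc of `(D; b, a)` (from `b` to `a`) is the second arc `(ba)` of `(D; a, b)`. [folklore] -/
@[simp] theorem arc_swap_zero : D.swap.arc 0 = D.arc 1 := by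
  simp only [arc, nextMark_zero_two, nextMark_one_two, mark_swap_zero, mark_swap_one]
  rw [show D.swap.boundary = D.boundary ∘ fun t => t + D.mark 1 from rfl, image_comp,
    image_add_const_Icc]
  congr 2 <;> ring

/-- The second arc of `(D; b, a)` (from `a` back to `b`) is the first arc `(ab)` of `(D; a, b)`. [folklore] -/
@[simp] theorem arc_swap_one : D.swap.arc 1 = D.arc 0 := by
  simp only [arc, nextMark_zero_two, nextMark_one_two, mark_swap_zero, mark_swap_one]
  rw [show D.swap.boundary = D.boundary ∘ fun t => t + D.mark 1 from rfl, image_comp,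
    image_add_const_Icc, show 1 + D.mark 0 - D.mark 1 + D.mark 1 = D.mark 0 + 1 by ring,
    show (0 : ℝ) + 1 + D.mark 1 = D.mark 1 + 1 by ring, ← image_add_const_Icc, ← image_comp]
  refine congrArg (· '' _) (funext fun t => ?_)
  exact D.periodic_boundary t

/-- Swapping twice returns the original marked points (the boundary loop is merely re-based at
`mark 0`). [folklore] -/
@[simp] theorem pt_swap_swap (i : Fin 2) : D.swap.swap.pt i = D.pt i := by
  fin_cases i <;> simp

end MarkedDomain

/-! ### Reversible chordal families -/

namespace ChordalFamily

/-- **Reversibility** of a chordal curve family: the law of the curve from `b` to `a` in `D` is the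
time reversal of the law of the curve from `a` to `b`. Phrased without choosing a swapped domain:
for ALL Dobrushin structures `D'` on the same carrier as `D` with the two marked points exchanged,
`P D' = reverse_* (P D)`; for `D' = D.swap` see `IsReversible.apply_swap`, and for the converse
`isReversible_iff_swap`. Exact for the `x_c`-weighted self-avoiding walk (the weight `β^{-|ω|}` of
LSW 2004 §3.1 is invariant under `ω ↦ ω^R`); holds for every chordal conformal restriction family
("the symmetry relation `P^a(z,w;D) = P^a(w,z;D)`", LSW 2004 §2.2) and for chordal SLE_κ,
`κ ∈ (0, 4]` (Zhan 2008). This is hypothesis (iv) of `Rigidity` / a conjunct of `AxiomsOfLimit` in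
route SAWRestrictionRigidity. [cite: LawlerSchrammWerner2004SAW, §2.2] -/
def IsReversible (P : ChordalFamily) : Prop :=
  ∀ D D' : DobrushinDomain, D'.carrier = D.carrier → D'.pt 0 = D.pt 1 → D'.pt 1 = D.pt 0 →
    P D' = (P D).map CurveClass.reverse

variable {P : ChordalFamily}

/-- Unfolding `IsReversible` (the form inlined in route SAWRestrictionRigidity). [folklore] -/
theorem isReversible_iff (P : ChordalFamily) :
    P.IsReversible ↔
      ∀ D D' : DobrushinDomain, D'.carrier = D.carrier → D'.pt 0 = D.pt 1 → D'.pt 1 = D.pt 0 →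
        P D' = (P D).map CurveClass.reverse :=
  Iff.rfl

/-- A reversible family evaluated at the swapped domain `(D; b, a)`. [folklore] -/
theorem IsReversible.apply_swap (h : P.IsReversible) (D : DobrushinDomain) :
    P D.swap = (P D).map CurveClass.reverse :=
  h D D.swap D.carrier_swap D.pt_swap_zero D.pt_swap_one

/-- A reversible family on events: `P (D; b, a) (T) = P (D; a, b) (reverse ⁻¹' T)` for every set
`T`. [folklore] -/
theorem IsReversible.apply_swap_apply (h : P.IsReversible) (D : DobrushinDomain)
    (T : Set (CurveClass ℂ)) : P D.swap T = P D (CurveClass.reverse ⁻¹' T) := by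
  rw [h.apply_swap, CurveClass.map_reverse_apply]

/-- The symmetric form: reversing the law from `b` to `a` gives back the law from `a` to `b`. [folklore] -/
theorem IsReversible.map_reverse_eq (h : P.IsReversible) {D D' : DobrushinDomain}
    (hc : D'.carrier = D.carrier) (h0 : D'.pt 0 = D.pt 1) (h1 : D'.pt 1 = D.pt 0) :
    (P D').map CurveClass.reverse = P D := by
  rw [h D D' hc h0 h1, CurveClass.map_reverse_map_reverse]

/-- Almost-sure properties of the curve from `b` to `a` are almost-sure properties of the reversed
curve from `a` to `b`. [folklore] -/
theorem IsReversible.ae_swap_iff (h : P.IsReversible) (D : DobrushinDomain)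
    {p : CurveClass ℂ → Prop} : (∀ᵐ γ ∂(P D.swap), p γ) ↔ ∀ᵐ γ ∂(P D), p γ.reverse := by
  rw [h.apply_swap]
  exact CurveClass.ae_map_reverse_iff

/-- A reversible family takes the same value on two Dobrushin structures with the same carrier and
the same marked points (swap twice). [folklore] -/
theorem IsReversible.eq_of_carrier_eq (h : P.IsReversible) {D D' : DobrushinDomain}
    (hc : D'.carrier = D.carrier) (h0 : D'.pt 0 = D.pt 0) (h1 : D'.pt 1 = D.pt 1) :
    P D' = P D := by
  rw [h D.swap D' (by simpa using hc) (by simpa using h0) (by simpa using h1), h.apply_swap,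
    CurveClass.map_reverse_map_reverse]

/-- Converse direction: if `P` depends on a Dobrushin domain only through its carrier and its two
marked points, reversibility needs checking only at `D.swap`. [folklore] -/
theorem isReversible_of_swap
    (hP : ∀ D D' : DobrushinDomain, D'.carrier = D.carrier → D'.pt 0 = D.pt 0 →
      D'.pt 1 = D.pt 1 → P D' = P D)
    (h : ∀ D : DobrushinDomain, P D.swap = (P D).map CurveClass.reverse) : P.IsReversible := by
  intro D D' hc h0 h1
  rw [← h D]
  exact hP D.swap D' (by simpa using hc) (by simpa using h0) (by simpa using h1)

/-- For families depending on `D` only through `(carrier, pt 0, pt 1)`: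
`IsReversible P ↔ ∀ D, P D.swap = reverse_* (P D)`. [folklore] -/
theorem isReversible_iff_swap
    (hP : ∀ D D' : DobrushinDomain, D'.carrier = D.carrier → D'.pt 0 = D.pt 0 →
      D'.pt 1 = D.pt 1 → P D' = P D) :
    P.IsReversible ↔ ∀ D : DobrushinDomain, P D.swap = (P D).map CurveClass.reverse :=
  ⟨fun h D => h.apply_swap D, isReversible_of_swap hP⟩

/-! #### Chordal restriction families depend on `D` only through `(carrier, a, b)` -/

/-- For a chordal family, the curve of `P D` almost surely stays in `D̄`: the complement of
`{γ ⊆ D̄}` is `P D`-null. [folklore] -/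
theorem IsChordal.compl_rangeSubset_null (hC : P.IsChordal) (D : DobrushinDomain) :
    P D (CurveClass.rangeSubset (closure D.carrier))ᶜ = 0 :=
  measure_mono_null (fun _ h => h) (ae_iff.1 ((hC D).2.mono fun _ h => h.2.2))

/-- For a chordal family, `P D {γ ⊆ D̄} = 1`. [folklore] -/
theorem IsChordal.measure_rangeSubset (hC : P.IsChordal) (D : DobrushinDomain) :
    P D (CurveClass.rangeSubset (closure D.carrier)) = 1 := by
  haveI := (hC D).1
  exact (prob_compl_eq_zero_iff (CurveClass.measurableSet_rangeSubset isClosed_closure)).1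
    (hC.compl_rangeSubset_null D)

/-- A chordal family with the restriction property depends on a Dobrushin domain only through its
carrier and its marked points: with `D' = D` as sets and the same `a, b`, the restriction identity
`P D' (T) · P D {γ ⊆ D̄} = P D (T ∩ {γ ⊆ D̄})` and `P D {γ ⊆ D̄} = 1` give `P D' = P D`.
(So for such families `isReversible_iff_swap` applies.) [folklore] -/
theorem IsRestriction.eq_of_carrier_eq (hR : P.IsRestriction) (hC : P.IsChordal)
    {D D' : DobrushinDomain} (hc : D'.carrier = D.carrier) (h0 : D'.pt 0 = D.pt 0)
    (h1 : D'.pt 1 = D.pt 1) : P D' = P D := by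
  ext T hT
  have key := hR D D' hc.subset h0 h1 T hT
  rwa [hc, hC.measure_rangeSubset D, mul_one,
    measure_inter_conull (hC.compl_rangeSubset_null D)] at key

/-- For chordal restriction families, reversibility is the single identity
`P (D; b, a) = reverse_* P (D; a, b)` at the swapped domain. [folklore] -/
theorem isReversible_iff_swap_of_isRestriction (hR : P.IsRestriction) (hC : P.IsChordal) :
    P.IsReversible ↔ ∀ D : DobrushinDomain, P D.swap = (P D).map CurveClass.reverse :=
  isReversible_iff_swap fun _ _ hc h0 h1 => hR.eq_of_carrier_eq hC hc h0 h1

end ChordalFamily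

/-! ### Non-vacuity: the straight-segment family is reversible -/

namespace Curve

/-- The straight segment from `a` to `b`, `t ↦ a + t (b − a)`. [folklore] -/
def segment (a b : ℂ) : Curve ℂ :=
  ⟨⟨fun t : I => a + ((t : ℝ) : ℂ) * (b - a), by fun_prop⟩⟩

/-- Pointwise formula for `segment`. [folklore] -/
@[simp] theorem segment_apply (a b : ℂ) (t : I) : segment a b t = a + ((t : ℝ) : ℂ) * (b - a) :=
  rfl

/-- Reversing the segment from `a` to `b` gives the segment from `b` to `a`. [folklore] -/
@[simp] theorem reverse_segment (a b : ℂ) : (segment a b).reverse = segment b a := by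
  ext t
  change a + (((σ t : I) : ℝ) : ℂ) * (b - a) = b + ((t : ℝ) : ℂ) * (a - b)
  rw [unitInterval.coe_symm_eq, Complex.ofReal_sub, Complex.ofReal_one]
  ring

end Curve

/-- The **segment family**: Dirac mass on the straight segment from `a = D.pt 0` to `b = D.pt 1`
(a toy family; it depends on `D` only through the marked points). [folklore] -/
def segmentFamily : ChordalFamily := fun D =>
  Measure.dirac (CurveClass.mk (Curve.segment (D.pt 0) (D.pt 1)))

/-- The segment family is reversible: `IsReversible` is non-vacuous. [folklore] -/
theorem isReversible_segmentFamily : segmentFamily.IsReversible := by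
  intro D D' _ h0 h1
  simp only [segmentFamily, h0, h1]
  rw [Measure.map_dirac' CurveClass.measurable_reverse, CurveClass.reverse_mk, Curve.reverse_segment]

end Literature.Probability.RandomPlanarGeometry
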